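import Summits.ValiantsHypothesis.ValiantsHypothesis.Theorems.LacunarySymmetroidMatrixDescartesFirstRung
import Summits.ValiantsHypothesis.ValiantsHypothesis.Theorems.LacunarySymmetroidMatrixDescartesCensusPivotDefs

/-!
# `MatrixDescartes` census — pivot column: R0 `OneSidedIndexRung` PROVED (one-sided pivot pencils have `Z₊ ≤` the pivot index)

HONEST FRAMING.  Object-search cell `pub-symmetroid`, Conjecture-B column in pivot currency (`…CensusPivotDefs.lean`); seat
conjb-1 g0 (author of the proof; HOME file `pub-symmetroid-conjb-1/OneSidedIndexRung.lean`, farm rc 0, 2026-08-25), moved onto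
the tree's shared `Pivot` vocabulary by the typer g8 (the verbatim local copies of the definitions are replaced by the import;
the mathematics is byte-for-byte conjb-1's).  THE THEOREM (R0 of the column): for a real symmetric `J` with `J + W Wᵀ ⪰ 0`
for some `ι × Fin q` matrix `W` (negative index `≤ q`), PSD letters `P k` and a pivot exponent `e` on ONE side of all `d k`,
the determinant of `X^e • J + ∑ X^{d k} • P k` has at most `q` distinct positive zeros — uniformly in `card ι`, the number of
letters and the exponents (`oneSidedIndexRung_holds : OneSidedIndexRung`; sharpens the tree's `firstRung_oneSided`, `Z₊ ≤ card ι`).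
PROOF = the tree's inertia chain (`…StubInertiaChain`) run DOWNWARD: below all kernel times the quadratic form of `G s` is
negative definite on the span of the kernel vectors, while `J + W Wᵀ ⪰ 0` forbids a `J`-negative vector in `ker Wᵀ` — and
`ker Wᵀ` meets every subspace of dimension `> q`; the high case `d k ≤ e` is the low case after the tree's reversal
`x ↦ 1/x` (`stub_reverse`).
Landed as a HELPER of the crux item stmt-ValiantsHypothesis-18050 with no closure claim; a theorem about one-sided pivot
pencils only (the excess of `Z₊` over the index is an interleaved-exponent phenomenon: `…CensusPivotRankOne.lean`) — nothing
here bears on `Theses.LacunarySymmetroid.MatrixDescartes`, on `KPlusLogSqLaw`, or on `VP ≠ VNP`.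

[folklore] Sylvester inertia / Loewner monotonicity / kernel dimension count; no single source.
-/

-- `Summit.ValiantsHypothesis.ValiantsHypothesis.…` repeats a component by the D-0017 layout
-- (single-conjunct summit), which the `dupNamespace` linter flags; the name is mandated.
set_option linter.dupNamespace false

namespace Summit.ValiantsHypothesis.ValiantsHypothesis.Theorems.LacunarySymmetroidMatrixDescartes.Pivot.IndexRung

open Matrix Finset Polynomial
open scoped BigOperators
open Summit.ValiantsHypothesis.ValiantsHypothesis.Theorems.LacunarySymmetroidMatrixDescartes
open Summit.ValiantsHypothesis.ValiantsHypothesis.Theorems.LacunarySymmetroidMatrixDescartes.StubInertiaChain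

/-- Mirror of `StubInertiaChain.step`: at the kernel time `A *ᵥ y = 0`, an EARLIER matrix `B ≤ A`,
`y ⬝ᵥ B y < 0`; negativity of `A` at `u` (or `u = 0`, `a ≠ 0`) gives negativity of `B` at `u + a • y`. -/
theorem stepNeg {ι : Type*} [Fintype ι] {A B : Matrix ι ι ℝ} (hA : A.IsSymm)
    (hBA : (A - B).PosSemidef) {y : ι → ℝ} (hy : A *ᵥ y = 0) (hyB : y ⬝ᵥ (B *ᵥ y) < 0)
    {u : ι → ℝ} {a : ℝ} (h : u ⬝ᵥ (A *ᵥ u) < 0 ∨ (u = 0 ∧ a ≠ 0)) :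
    (u + a • y) ⬝ᵥ (B *ᵥ (u + a • y)) < 0 := by
  rcases h with hu | ⟨rfl, ha⟩
  · calc (u + a • y) ⬝ᵥ (B *ᵥ (u + a • y))
        ≤ (u + a • y) ⬝ᵥ (A *ᵥ (u + a • y)) := quadForm_mono hBA _
      _ = u ⬝ᵥ (A *ᵥ u) := quadForm_add_smul_of_mulVec_eq_zero hA hy u a
      _ < 0 := hu
  · rw [zero_add, quadForm_smul]
    exact mul_neg_of_pos_of_neg (mul_self_pos.2 ha) hyB

/-- **Downward inertia chain.** `G` symmetric, Loewner non-decreasing on `(0,∞)`; kernel vectors `v j` at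
strictly increasing positive times `τ j` whose own quadratic form is NEGATIVE before the kernel time.
Then below all kernel times the quadratic form of `G s` is strictly negative at every nontrivial
combination `∑ c i • v i`. -/
theorem quadForm_sum_neg {ι : Type*} [Fintype ι] (G : ℝ → Matrix ι ι ℝ)
    (hG : ∀ s, (G s).IsSymm) (hmono : ∀ s t : ℝ, 0 < s → s ≤ t → (G t - G s).PosSemidef) :
    ∀ (k : ℕ) (τ : Fin k → ℝ) (v : Fin k → (ι → ℝ)), StrictMono τ → (∀ j, 0 < τ j) →
      (∀ j, G (τ j) *ᵥ v j = 0) → (∀ j (s : ℝ), 0 < s → s < τ j → v j ⬝ᵥ (G s *ᵥ v j) < 0) →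
      ∀ c : Fin k → ℝ, (∃ i, c i ≠ 0) → ∀ s : ℝ, 0 < s → (∀ j, s < τ j) →
        (∑ i, c i • v i) ⬝ᵥ (G s *ᵥ ∑ i, c i • v i) < 0
  | 0, _, _, _, _, _, _, _, ⟨i, _⟩, _, _, _ => i.elim0
  | k + 1, τ, v, hτ, hτpos, hker, hneg, c, hc, s, hs0, hs => by
    -- split off the FIRST index: `∑ i, c i • v i = u + a • y` with `y = v 0`
    have hsplit : ∑ i, c i • v i =
        (∑ i : Fin k, c (Fin.succ i) • v (Fin.succ i)) + c 0 • v 0 := by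
      rw [Fin.sum_univ_succ, add_comm]
    rw [hsplit]
    refine stepNeg (hG (τ 0)) (hmono s (τ 0) hs0 (hs 0).le) (hker 0) (hneg 0 s hs0 (hs 0)) ?_
    by_cases hc' : ∃ i : Fin k, c (Fin.succ i) ≠ 0
    · -- some later coefficient is nonzero: induction hypothesis at the kernel time `τ 0`,
      -- which is below all the later times by strict monotonicity of `τ`
      exact Or.inl (quadForm_sum_neg G hG hmono k (fun i => τ (Fin.succ i))
        (fun i => v (Fin.succ i)) (hτ.comp (Fin.strictMono_succ)) (fun j => hτpos (Fin.succ j))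
        (fun j => hker (Fin.succ j)) (fun j => hneg (Fin.succ j)) (fun i => c (Fin.succ i)) hc'
        (τ 0) (hτpos 0) fun j => hτ (Fin.succ_pos j))
    · push Not at hc'
      refine Or.inr ⟨Finset.sum_eq_zero fun i _ => by rw [hc' i, zero_smul], fun ha => ?_⟩
      obtain ⟨i, hi⟩ := hc
      rcases Fin.eq_zero_or_eq_succ i with rfl | ⟨j, rfl⟩
      · exact hi ha
      · exact hi (hc' j)


/-- Expansion of the pencil quadratic form. -/
theorem quadForm_pencil {ι κ : Type} [Fintype ι] [Fintype κ] (e : ℕ) (d : κ → ℕ)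
    (J : Matrix ι ι ℝ) (P : κ → Matrix ι ι ℝ) (v : ι → ℝ) (t : ℝ) :
    v ⬝ᵥ ((J + ∑ k, (t ^ (d k - e)) • P k) *ᵥ v)
      = v ⬝ᵥ (J *ᵥ v) + ∑ k, t ^ (d k - e) * (v ⬝ᵥ (P k *ᵥ v)) := by
  simp only [Matrix.add_mulVec, Matrix.sum_mulVec, Matrix.smul_mulVec, dotProduct_add, dotProduct_sum,
    dotProduct_smul, smul_eq_mul]

/-- Strict negativity BEFORE the kernel time, from positivity AFTER it (pencil structure: the quadratic
form is `A + ∑ Bₖ t^{cₖ}` with `Bₖ ≥ 0`). -/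
theorem quadForm_neg_before {ι κ : Type} [Fintype ι] [Fintype κ] (e : ℕ) (d : κ → ℕ)
    (J : Matrix ι ι ℝ) (P : κ → Matrix ι ι ℝ) (hP : ∀ k, (P k).PosSemidef) (v : ι → ℝ) (τ : ℝ)
    (_hτ : 0 < τ) (hker : (J + ∑ k, (τ ^ (d k - e)) • P k) *ᵥ v = 0)
    (hpos : ∀ s : ℝ, τ < s → 0 < v ⬝ᵥ ((J + ∑ k, (s ^ (d k - e)) • P k) *ᵥ v))
    (s : ℝ) (hs0 : 0 < s) (hs : s < τ) :
    v ⬝ᵥ ((J + ∑ k, (s ^ (d k - e)) • P k) *ᵥ v) < 0 := by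
  have hB : ∀ k, 0 ≤ v ⬝ᵥ (P k *ᵥ v) := fun k => by
    simpa only [star_trivial] using (hP k).dotProduct_mulVec_nonneg v
  have h0 : v ⬝ᵥ (J *ᵥ v) + ∑ k, τ ^ (d k - e) * (v ⬝ᵥ (P k *ᵥ v)) = 0 := by
    rw [← quadForm_pencil, hker, dotProduct_zero]
  rw [quadForm_pencil]
  -- termwise `s^{c} B ≤ τ^{c} B`
  have hle : ∀ k, s ^ (d k - e) * (v ⬝ᵥ (P k *ᵥ v)) ≤ τ ^ (d k - e) * (v ⬝ᵥ (P k *ᵥ v)) := fun k =>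
    mul_le_mul_of_nonneg_right (pow_le_pow_left₀ hs0.le hs.le _) (hB k)
  rcases (Finset.sum_le_sum fun k (_ : k ∈ Finset.univ) => hle k).lt_or_eq with hlt | heq
  · linarith
  · -- equality forces every term with `cₖ ≠ 0` to have `Bₖ = 0`; then the form is constant in `t`
    exfalso
    have hterm : ∀ k, s ^ (d k - e) * (v ⬝ᵥ (P k *ᵥ v)) = τ ^ (d k - e) * (v ⬝ᵥ (P k *ᵥ v)) := by
      have := (Finset.sum_eq_sum_iff_of_le (fun k (_ : k ∈ Finset.univ) => hle k)).1 heq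
      exact fun k => this k (Finset.mem_univ k)
    have hconst : ∀ k, (τ + 1) ^ (d k - e) * (v ⬝ᵥ (P k *ᵥ v)) = τ ^ (d k - e) * (v ⬝ᵥ (P k *ᵥ v)) := by
      intro k
      by_cases hc : d k - e = 0
      · simp [hc]
      · have hslt : s ^ (d k - e) < τ ^ (d k - e) := pow_lt_pow_left₀ hs hs0.le hc
        have hBk : v ⬝ᵥ (P k *ᵥ v) = 0 := by
          by_contra hne
          have hBpos : 0 < v ⬝ᵥ (P k *ᵥ v) := lt_of_le_of_ne (hB k) (Ne.symm hne)
          have := mul_lt_mul_of_pos_right hslt hBpos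
          linarith [hterm k]
        simp [hBk]
    have h1 := hpos (τ + 1) (by linarith)
    rw [quadForm_pencil, Finset.sum_congr rfl fun k _ => hconst k] at h1
    linarith

/-- **R0 = `OneSidedIndexRung`, low case.**  If `e ≤ d k` for all `k`, `P k ⪰ 0`, `J` symmetric with
`J + W Wᵀ ⪰ 0` for an `ι × Fin q` matrix `W`, then `det (X^e J + ∑ X^{d k} P k)` has at most `q` distinct
positive zeros. -/
theorem oneSidedIndexRung_low (ι κ : Type) [Fintype ι] [DecidableEq ι] [Fintype κ] (e : ℕ) (d : κ → ℕ)
    (J : Matrix ι ι ℝ) (P : κ → Matrix ι ι ℝ) (hJ : J.IsSymm) (hP : ∀ k, (P k).PosSemidef)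
    (hd : ∀ k, e ≤ d k) (q : ℕ) (W : Matrix ι (Fin q) ℝ) (hW : (J + W * Wᵀ).PosSemidef) :
    ((Matrix.det (((Polynomial.X : Polynomial ℝ) ^ e) • J.map Polynomial.C
        + ∑ k, ((Polynomial.X : Polynomial ℝ) ^ d k) • (P k).map Polynomial.C)).roots.toFinset.filter
          (fun t => 0 < t)).card ≤ q := by
  set p := Matrix.det (((Polynomial.X : Polynomial ℝ) ^ e) • J.map Polynomial.C
        + ∑ k, ((Polynomial.X : Polynomial ℝ) ^ d k) • (P k).map Polynomial.C) with hp
  by_cases hdet : p = 0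
  · simp [hdet]
  set R := p.roots.toFinset.filter (fun t => 0 < t) with hR
  let τ : Fin R.card ↪o ℝ := R.orderEmbOfFin rfl
  have hτmem : ∀ j, τ j ∈ R := fun j => R.orderEmbOfFin_mem rfl j
  have hτpos : ∀ j, 0 < τ j := fun j => (Finset.mem_filter.1 (hτmem j)).2
  have hτroot : ∀ j, p.IsRoot (τ j) := fun j => by
    have h1 := (Finset.mem_filter.1 (hτmem j)).1
    rw [Multiset.mem_toFinset] at h1
    exact (Polynomial.mem_roots hdet).1 h1
  have hdata : ∀ j, ∃ v : ι → ℝ, v ≠ 0 ∧ (J + ∑ k, (τ j ^ (d k - e)) • P k) *ᵥ v = 0 ∧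
      ∀ s : ℝ, τ j < s → 0 < v ⬝ᵥ ((J + ∑ k, (s ^ (d k - e)) • P k) *ᵥ v) := fun j =>
    stub_kernelData ι κ e d J P hJ hP hd hdet (τ j) (hτpos j) (hτroot j)
  choose v _hv0 hker hpos using hdata
  -- the Loewner-monotone family
  let G : ℝ → Matrix ι ι ℝ := fun s => J + ∑ k, (s ^ (d k - e)) • P k
  have hPk : ∀ k, (P k).IsSymm := fun k => Matrix.isHermitian_iff_isSymm.1 (hP k).1
  have hG : ∀ s : ℝ, (G s).IsSymm := by
    intro s
    show (J + ∑ k, (s ^ (d k - e)) • P k).IsSymm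
    unfold Matrix.IsSymm
    rw [Matrix.transpose_add, Matrix.transpose_sum, hJ.eq]
    congr 1
    exact Finset.sum_congr rfl fun k _ => by rw [Matrix.transpose_smul, (hPk k).eq]
  have hdiffPSD : ∀ s t : ℝ, 0 ≤ s → s ≤ t → (G t - G s).PosSemidef := by
    intro s t hs hst
    have hdiff : G t - G s = ∑ k, (t ^ (d k - e) - s ^ (d k - e)) • P k := by
      show (J + ∑ k, (t ^ (d k - e)) • P k) - (J + ∑ k, (s ^ (d k - e)) • P k) = _
      simp only [sub_smul, Finset.sum_sub_distrib]
      abel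
    rw [hdiff]
    refine Matrix.posSemidef_sum Finset.univ fun k _ => ?_
    exact (hP k).smul (sub_nonneg.2 (pow_le_pow_left₀ hs hst _))
  have hmono : ∀ s t : ℝ, 0 < s → s ≤ t → (G t - G s).PosSemidef := fun s t hs hst =>
    hdiffPSD s t hs.le hst
  have hneg : ∀ j (s : ℝ), 0 < s → s < τ j → v j ⬝ᵥ (G s *ᵥ v j) < 0 := fun j s hs0 hs =>
    quadForm_neg_before e d J P hP (v j) (τ j) (hτpos j) (hker j) (hpos j) s hs0 hs
  -- if there were more than `q` roots, some nontrivial combination `x` of the `v j` lies in `ker Wᵀ`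
  by_contra hlt
  push Not at hlt
  have hk : 0 < R.card := lt_of_le_of_lt (Nat.zero_le q) hlt
  let L : (Fin R.card → ℝ) →ₗ[ℝ] (Fin q → ℝ) :=
    (Matrix.mulVecLin Wᵀ).comp (Fintype.linearCombination ℝ v)
  have hker_ne : LinearMap.ker L ≠ ⊥ := by
    apply LinearMap.ker_ne_bot_of_finrank_lt
    simpa [Module.finrank_fin_fun] using hlt
  obtain ⟨c, hcL, hc0⟩ := (Submodule.ne_bot_iff _).1 hker_ne
  have hc : ∃ i, c i ≠ 0 := by
    by_contra h
    push Not at h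
    exact hc0 (funext h)
  set x : ι → ℝ := ∑ i, c i • v i with hx
  have hWx : Wᵀ *ᵥ x = 0 := by
    have := LinearMap.mem_ker.1 hcL
    simp only [L, LinearMap.coe_comp, Function.comp_apply, Fintype.linearCombination_apply,
      Matrix.mulVecLin_apply] at this
    rw [hx]
    exact this
  -- `J + W Wᵀ ⪰ 0` and `Wᵀ x = 0` give `0 ≤ x ⬝ J x`
  have hJx : 0 ≤ x ⬝ᵥ (J *ᵥ x) := by
    have h := hW.dotProduct_mulVec_nonneg x
    rw [star_trivial, Matrix.add_mulVec, ← Matrix.mulVec_mulVec, hWx, Matrix.mulVec_zero, add_zero] at h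
    exact h
  -- below the first kernel time the form of `G s₀ ≥ J` is negative at `x`: contradiction
  set s₀ : ℝ := τ ⟨0, hk⟩ / 2 with hs₀
  have hs₀pos : 0 < s₀ := by rw [hs₀]; linarith [hτpos ⟨0, hk⟩]
  have hs₀lt : ∀ j, s₀ < τ j := fun j => by
    have : τ ⟨0, hk⟩ ≤ τ j := τ.monotone (Fin.mk_le_mk.2 (Nat.zero_le _))
    have : s₀ < τ ⟨0, hk⟩ := by rw [hs₀]; linarith [hτpos ⟨0, hk⟩]
    linarith
  have hnegx : x ⬝ᵥ (G s₀ *ᵥ x) < 0 :=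
    quadForm_sum_neg G hG hmono R.card τ v τ.strictMono hτpos hker hneg c hc s₀ hs₀pos hs₀lt
  have hGJ : x ⬝ᵥ (J *ᵥ x) ≤ x ⬝ᵥ (G s₀ *ᵥ x) := by
    refine quadForm_mono ?_ x
    have : G s₀ - J = ∑ k, (s₀ ^ (d k - e)) • P k := by
      show (J + ∑ k, (s₀ ^ (d k - e)) • P k) - J = _
      abel
    rw [this]
    exact Matrix.posSemidef_sum Finset.univ fun k _ => (hP k).smul (pow_nonneg hs₀pos.le _)
  linarith

/-- **R0, high case** (`d k ≤ e`), by the reflection `X ↦ 1/X` (`stub_reverse`). -/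
theorem oneSidedIndexRung_high (ι κ : Type) [Fintype ι] [DecidableEq ι] [Fintype κ] (e : ℕ) (d : κ → ℕ)
    (J : Matrix ι ι ℝ) (P : κ → Matrix ι ι ℝ) (hJ : J.IsSymm) (hP : ∀ k, (P k).PosSemidef)
    (hd : ∀ k, d k ≤ e) (q : ℕ) (W : Matrix ι (Fin q) ℝ) (hW : (J + W * Wᵀ).PosSemidef) :
    ((Matrix.det (((Polynomial.X : Polynomial ℝ) ^ e) • J.map Polynomial.C
        + ∑ k, ((Polynomial.X : Polynomial ℝ) ^ d k) • (P k).map Polynomial.C)).roots.toFinset.filter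
          (fun t => 0 < t)).card ≤ q := by
  rw [stub_reverse ι κ e e d J P le_rfl hd]
  exact oneSidedIndexRung_low ι κ (e - e) (fun k => e - d k) J P hJ hP (fun k => by omega) q W hW

/-- **R0 `OneSidedIndexRung` (both one-sided cases): `Z₊ ≤ q` = the pivot index, uniformly in
`card ι`, the number of letters and the exponents.**  Sharpens `firstRung_oneSided` (`Z₊ ≤ card ι`). -/
theorem oneSidedIndexRung (ι κ : Type) [Fintype ι] [DecidableEq ι] [Fintype κ] (e : ℕ) (d : κ → ℕ)
    (J : Matrix ι ι ℝ) (P : κ → Matrix ι ι ℝ) (hJ : J.IsSymm) (hP : ∀ k, (P k).PosSemidef)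
    (hone : (∀ k, e ≤ d k) ∨ (∀ k, d k ≤ e)) (q : ℕ) (W : Matrix ι (Fin q) ℝ)
    (hW : (J + W * Wᵀ).PosSemidef) :
    ((Matrix.det (((Polynomial.X : Polynomial ℝ) ^ e) • J.map Polynomial.C
        + ∑ k, ((Polynomial.X : Polynomial ℝ) ^ d k) • (P k).map Polynomial.C)).roots.toFinset.filter
          (fun t => 0 < t)).card ≤ q := by
  rcases hone with h | h
  · exact oneSidedIndexRung_low ι κ e d J P hJ hP h q W hW
  · exact oneSidedIndexRung_high ι κ e d J P hJ hP h q W hW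

end Summit.ValiantsHypothesis.ValiantsHypothesis.Theorems.LacunarySymmetroidMatrixDescartes.Pivot.IndexRung

namespace Summit.ValiantsHypothesis.ValiantsHypothesis.Theorems.LacunarySymmetroidMatrixDescartes.Pivot

/-- **R0 holds: `OneSidedIndexRung`** (conjb-1 g0) — every one-sided pivot pencil of format `(m, K)` and index `≤ q` has
`Z₊ ≤ q`, i.e. `OneSidedPivotRootLawAt m K q q` for all `m K q`. -/
theorem oneSidedIndexRung_holds : OneSidedIndexRung :=
  fun m K q e d J P hJ hP ⟨W, hW⟩ hone => IndexRung.oneSidedIndexRung (Fin m) (Fin K) e d J P hJ hP hone q W hW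

end Summit.ValiantsHypothesis.ValiantsHypothesis.Theorems.LacunarySymmetroidMatrixDescartes.Pivot
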